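import Mathlib
import HarnessLib
import Summits.Langlands.Statement
import Summits.Langlands.Langlands.Theses.DepthPrimeSplit
import Summits.Langlands.Langlands.Theses.WeightMultiplicitySplit
import Summits.Langlands.Langlands.Theorems.WeightMultiplicitySplitMinusculeHodgeType
import Literature.NumberTheory.GaloisRepresentations.LabelledHodgeTateWeights
import Literature.NumberTheory.PAdicHodge.FontaineDpst
import Literature.NumberTheory.GaloisRepresentations.LabelledWeightsDeRhamRank
import Summits.Langlands.Langlands.Theses.ClassicalityWeightSplit
set_option linter.dupNamespace false
set_option linter.unusedVariables false

/-!
# Birth skeleton (BC3) for crux `ClassicalityWeightSplit.DegenerateClassicality` — line `birth` (AFTER-BIRTH form: the route decl BY NAME)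

Route `ClassicalityWeightSplit` (decomp-langlands lens-2 g17; child route at `DepthPrimeSplit.Classicality` stmt-Langlands-25026).  The crux is
the DEGENERATE chamber of CLASS (some labelled Hodge–Tate weight of multiplicity ≥ 3) — the route's DECLARED RESIDUAL (NonRegularWeightBarrier, narrow clause): rank ≤ 2 is EMPTY (kernel: the tree's `card = n`); at rank ≥ 3 cut by the ISOTYPIC sub-dial (all labelled weights equal = Artin type up to a labelled twist: «pro-automorphic limits of Artin motives», registered core CMFern.ClassicalityOfArtinLimits stmt-13888 for n ≥ 3) versus MIXED degenerate.

Shape (for `ledger skeleton check` / `#h21_check_skeleton`): stubs `theorem stub_<name> : <signature> := by sorry` (each a layer-2 SUB-BOX of the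
cell: the cell's text VERBATIM with ONE rank clause after `0 < n →` — and, for the degenerate cell at rank ≥ 3, the isotypic sub-dial — so no stub
restates the cell, the target CLASS or the summit: probes B6 of the node kit), `namespace _Goal` with `def stub_<name> : Prop := type_of% @stub_<name>`
naming each statement, and the kernel-checked composition `DegenerateClassicality_of (h₁ : _Goal.stub_…) … : <the crux BY NAME>` (seam =
`omega` on the rank; the rank ≤ 2 chamber is discharged INSIDE the composition by the rank bound — it is empty — and rank ≥ 3 splits by excluded middle on the isotypic sub-dial).  `lean check --json`: rc 0, sorries = the stubs (2 or 3), none elsewhere.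
After birth this AFTER-BIRTH form (route decl BY NAME via `import Summits.Langlands.Langlands.Theses.ClassicalityWeightSplit`) is published with
`ledger crux write <item> Lines/birth.lean --file <this file>` + `ledger skeleton check $(ledger crux dir <item>)/Lines/birth.lean --crux <item>`.
-/

namespace Summit.Langlands.Langlands.Cruxes.DegenerateClassicality.Birth

open scoped NumberField
open Filter IsDedekindDomain Literature.NumberTheory.GaloisRepresentations
open Summit.Langlands.Langlands.Theorems.WeightMultiplicitySplitMinusculeHodgeType (HodgeTateMultLE IsWallHT)

-- the crux BY NAME: `Summit.Langlands.Langlands.Theses.ClassicalityWeightSplit.DegenerateClassicality` (the born route file).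

/-- RANK BOUND (tree theorem `FramedGaloisRep.card_labelledHodgeTateWeightsAt_eq_of_isDeRhamFramed`: de Rham for the pinned datum ⟹ exactly `n`
labelled weights at every label): every labelled multiplicity of a rank-`n` `ρ` de Rham above `ℓ` is `≤ k` whenever `n ≤ k`. -/
theorem hodgeTateMultLE_of_rank_le {K : Type} [Field K] [NumberField K] {n ℓ : ℕ} [Fact ℓ.Prime]
    {ρ : FramedGaloisRep K (PadicAlgCl ℓ) n}
    (hdR : ∀ (v : HeightOneSpectrum (𝓞 K)) (hv : ((ℓ : ℕ) : 𝓞 K) ∈ v.asIdeal),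
      (Literature.NumberTheory.PAdicHodge.fontainePstAdicCompletion v ℓ hv).IsDeRhamFramed (ρ.toLocal v))
    {k : ℕ} (hk : n ≤ k) : HodgeTateMultLE k ρ :=
  fun v hv τ hτ w =>
    ((Multiset.count_le_card w _).trans (FramedGaloisRep.card_labelledHodgeTateWeightsAt_eq_of_isDeRhamFramed ρ v hv (hdR v hv) τ hτ).le).trans hk

/-- stub · `stub_degenerateIsotypic` — CD at rank ≥ 3, Hodge–Tate ISOTYPIC (every labelled weight multiset constant): a pro-automorphic irreducible `ρ` of Artin type up to a labelled twist is weakly automorphic.  Why plausibly true: it is implied by reciprocity; the approximating π_m force the twist-normalised ρ to have finite image on an open subgroup (Sen operator 0 ⟹ potentially unramified at ℓ; pro-automorphy bounds the prime-to-ℓ conductor), so the statement is «ℓ-adic limits of cuspidal π that converge to an Artin representation are (limits of) weight-−ρ forms» — the GL₄/ℚ even Artin case is route EvenArtinGL4Door's crux 2905.  Why it might fail: NO engine (no Sen-theoretic classicality in weight −ρ, no coherent realisation: NonRegularWeightBarrier + the archimedean wall); this is the residual's hard core.  Size: XL / open problem. -/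
theorem stub_degenerateIsotypic :
    ∀ (K : Type) [Field K] [NumberField K] (n : ℕ) (hcpt : Literature.NumberTheory.Automorphic.isCompact_glFiniteIntegralLevel n K), 0 < n → 3 ≤ n → ∀ (ℓ : ℕ) [Fact ℓ.Prime] (ι : PadicAlgCl ℓ ≃+* ℂ) (ρ : Literature.NumberTheory.GaloisRepresentations.FramedGaloisRep K (PadicAlgCl ℓ) n), ρ.toGaloisRep.IsIrreducible → ((∀ᶠ v : IsDedekindDomain.HeightOneSpectrum (NumberField.RingOfIntegers K) in cofinite, ρ.IsUnramifiedAt v) ∧ ∀ (v : IsDedekindDomain.HeightOneSpectrum (NumberField.RingOfIntegers K)) (hv : ((ℓ : ℕ) : NumberField.RingOfIntegers K) ∈ v.asIdeal), (Literature.NumberTheory.PAdicHodge.fontainePstAdicCompletion v ℓ hv).IsDeRhamFramed (ρ.toLocal v)) → ¬ Summit.Langlands.Langlands.Theorems.WeightMultiplicitySplitMinusculeHodgeType.HodgeTateMultLE 2 ρ → (∀ (v : IsDedekindDomain.HeightOneSpectrum (NumberField.RingOfIntegers K)) (hv : ((ℓ : ℕ) : NumberField.RingOfIntegers K) ∈ v.asIdeal)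 (τ : v.adicCompletion K →+* PadicAlgCl ℓ), Continuous τ → ∃ a : ℤ, ∀ w ∈ ρ.labelledHodgeTateWeightsAt v (Literature.NumberTheory.PAdicHodge.fontainePstAdicCompletion v ℓ hv).algebra (Literature.NumberTheory.PAdicHodge.fontainePstAdicCompletion v ℓ hv).𝔅 τ, w = a) → (∃ S : Set (IsDedekindDomain.HeightOneSpectrum (NumberField.RingOfIntegers K)), S.Finite ∧ ∀ r : NNReal, 0 < r → ∃ π : Literature.NumberTheory.Automorphic.CuspidalAutomorphicRepData n K hcpt, π.1.IsLAlgebraic ∧ ∀ v : IsDedekindDomain.HeightOneSpectrum (NumberField.RingOfIntegers K), v ∉ S → (∃ α : Multiset ℂ, π.1.HasSatakeParamAt v α ∧ ∀ 𝔓 ∈ v.primesAbove, ∀ σ : Field.absoluteGaloisGroup K, IsArithFrobAt (NumberField.RingOfIntegers K) σ 𝔓 → ∀ i : ℕ, Valued.v ((Literature.NumberTheory.GaloisRepresentations.FramedRep.charpoly ρ σ - Literature.NumberTheory.Automorphic.arithFrobPolyOfSatake ι v.residueCard 1 α).coeff i) < r)) → ∃ π : Literature.NumberTheory.Automorphic.CuspidalAutomorphicRepData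 n K hcpt, π.1.IsLAlgebraic ∧ ∀ᶠ v : IsDedekindDomain.HeightOneSpectrum (NumberField.RingOfIntegers K) in cofinite, SatakeFrobCompatibleAt ι π.1 ρ v := by
  sorry

/-- stub · `stub_degenerateMixed` — CD at rank ≥ 3, NON-isotypic (a weight block of multiplicity ≥ 3 next to other weights, e.g. `{0,0,0,1}`).  Why plausibly true: implied by reciprocity; the only foothold is partial regularity at OTHER labels / blocks (partial classicality à la Ding, Breuil–Ding for partially de Rham families) — INSTRUMENTABLE at best.  Why it might fail: same barrier as the isotypic box plus mixed-parity archimedean parameters.  Size: XL / open problem. -/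
theorem stub_degenerateMixed :
    ∀ (K : Type) [Field K] [NumberField K] (n : ℕ) (hcpt : Literature.NumberTheory.Automorphic.isCompact_glFiniteIntegralLevel n K), 0 < n → 3 ≤ n → ∀ (ℓ : ℕ) [Fact ℓ.Prime] (ι : PadicAlgCl ℓ ≃+* ℂ) (ρ : Literature.NumberTheory.GaloisRepresentations.FramedGaloisRep K (PadicAlgCl ℓ) n), ρ.toGaloisRep.IsIrreducible → ((∀ᶠ v : IsDedekindDomain.HeightOneSpectrum (NumberField.RingOfIntegers K) in cofinite, ρ.IsUnramifiedAt v) ∧ ∀ (v : IsDedekindDomain.HeightOneSpectrum (NumberField.RingOfIntegers K)) (hv : ((ℓ : ℕ) : NumberField.RingOfIntegers K) ∈ v.asIdeal), (Literature.NumberTheory.PAdicHodge.fontainePstAdicCompletion v ℓ hv).IsDeRhamFramed (ρ.toLocal v)) → ¬ Summit.Langlands.Langlands.Theorems.WeightMultiplicitySplitMinusculeHodgeType.HodgeTateMultLE 2 ρ → ¬ (∀ (v : IsDedekindDomain.HeightOneSpectrum (NumberField.RingOfIntegers K)) (hv : ((ℓ : ℕ) : NumberField.RingOfIntegers K) ∈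 v.asIdeal) (τ : v.adicCompletion K →+* PadicAlgCl ℓ), Continuous τ → ∃ a : ℤ, ∀ w ∈ ρ.labelledHodgeTateWeightsAt v (Literature.NumberTheory.PAdicHodge.fontainePstAdicCompletion v ℓ hv).algebra (Literature.NumberTheory.PAdicHodge.fontainePstAdicCompletion v ℓ hv).𝔅 τ, w = a) → (∃ S : Set (IsDedekindDomain.HeightOneSpectrum (NumberField.RingOfIntegers K)), S.Finite ∧ ∀ r : NNReal, 0 < r → ∃ π : Literature.NumberTheory.Automorphic.CuspidalAutomorphicRepData n K hcpt, π.1.IsLAlgebraic ∧ ∀ v : IsDedekindDomain.HeightOneSpectrum (NumberField.RingOfIntegers K), v ∉ S → (∃ α : Multiset ℂ, π.1.HasSatakeParamAt v α ∧ ∀ 𝔓 ∈ v.primesAbove, ∀ σ : Field.absoluteGaloisGroup K, IsArithFrobAt (NumberField.RingOfIntegers K) σ 𝔓 → ∀ i : ℕ, Valued.v ((Literature.NumberTheory.GaloisRepresentations.FramedRep.charpoly ρ σ - Literature.NumberTheory.Automorphic.arithFrobPolyOfSatake ι v.residueCard 1 α).coeff i) < r)) → ∃ π : Literature.NumberTheory.Automorphic.CuspidalAutomorphicRepData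 n K hcpt, π.1.IsLAlgebraic ∧ ∀ᶠ v : IsDedekindDomain.HeightOneSpectrum (NumberField.RingOfIntegers K) in cofinite, SatakeFrobCompatibleAt ι π.1 ρ v := by
  sorry

namespace _Goal

/-- the statement of `stub_degenerateIsotypic` as a named Prop. -/
def stub_degenerateIsotypic : Prop :=
  type_of% @Summit.Langlands.Langlands.Cruxes.DegenerateClassicality.Birth.stub_degenerateIsotypic

/-- the statement of `stub_degenerateMixed` as a named Prop. -/
def stub_degenerateMixed : Prop :=
  type_of% @Summit.Langlands.Langlands.Cruxes.DegenerateClassicality.Birth.stub_degenerateMixed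

end _Goal

/-- **`DegenerateClassicality` from the two stubs** (kernel-checked, no sorry): the hypotheses are, by name, the statements of the stubs; the conclusion is the route decl `Summit.Langlands.Langlands.Theses.ClassicalityWeightSplit.DegenerateClassicality`; seam = `omega` on the rank; the rank ≤ 2 chamber is discharged INSIDE the composition by the rank bound — it is empty — and rank ≥ 3 splits by excluded middle on the isotypic sub-dial. -/
theorem DegenerateClassicality_of (h1 : _Goal.stub_degenerateIsotypic) (h2 : _Goal.stub_degenerateMixed) :
    Summit.Langlands.Langlands.Theses.ClassicalityWeightSplit.DegenerateClassicality := by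
  have ha : type_of% @stub_degenerateIsotypic := h1
  have hb : type_of% @stub_degenerateMixed := h2
  intro K _ _ n hcpt hn ℓ _ ι ρ hirr hgeo hd hpro
  rcases Nat.lt_or_ge n 3 with hlt | hge
  · exact (hd (hodgeTateMultLE_of_rank_le hgeo.2 (by omega))).elim
  · exact Classical.byCases (fun hiso => ha K n hcpt hn hge ℓ ι ρ hirr hgeo hd hiso hpro)
      (fun hiso => hb K n hcpt hn hge ℓ ι ρ hirr hgeo hd hiso hpro)

/-- By-name sanity check (an `example`, not a declaration of the file): the stubs feed the composition as they stand. -/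
example : Summit.Langlands.Langlands.Theses.ClassicalityWeightSplit.DegenerateClassicality :=
  DegenerateClassicality_of stub_degenerateIsotypic stub_degenerateMixed

/-- Hypothesis-free assembly (operator recipe 2026-08-30T22:10Z for `skeleton check`: a theorem concluding the crux BY NAME, assembled from the
sorried `stub_*` theorems — it inherits their `sorry`, nothing else). -/
theorem DegenerateClassicality_proof : Summit.Langlands.Langlands.Theses.ClassicalityWeightSplit.DegenerateClassicality :=
  DegenerateClassicality_of stub_degenerateIsotypic stub_degenerateMixed

end Summit.Langlands.Langlands.Cruxes.DegenerateClassicality.Birth
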